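import Summits.Ventures.HSemireg.WedgeHankelRecurrenceGaussChristoffelDarboux

/-!
# Venture HSemireg — **THE EXTREMAL PROPERTY OF THE ORTHOGONAL POLYNOMIAL**: among monic polynomials `P` of degree `n`, the `(ν, w)`-orthogonal one `q_n` MINIMISES `Σ_l ν_l P(w_l)²`
# (Pythagoras: `Σ ν P² = Σ ν q_n² + Σ ν (P − q_n)²`), uniquely when `ν > 0` and there are more than `n` nodes; CONVERSELY a monic minimiser is orthogonal to every polynomial of lower
# degree (first variation)

HONEST FRAMING. Part of the Lean index of the computation cell `pub-hsemireg` (seat p10 gen 42, Sunday typer «UNIFORM-IN-n»).  Real polynomials and finite sums only; no variety, no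
cohomology theory, no sheaf, no Ext group and no semiregularity map is constructed here; nothing here says that HC / HC_CM / HC_AV holds; no Literature fact (unproved `Prop`) is declared or
used.  Custodian versions as in `WedgeHankelSiegelIdeal` (1/3).
SOURCES (cited).  G. Szegő, *Orthogonal Polynomials*, AMS Colloq. Publ. 23, Thm 3.1.2 (the minimum of `∫ |π_n|² dα` over monic `π_n` of degree `n` is attained exactly at the monic orthogonal
polynomial) with §2.2 (2.2.7)–(2.2.8); T. S. Chihara, *An Introduction to Orthogonal Polynomials* (1978), Ch. I §3 (Ex. 3.6: the extremal property); N273 ∕ N274 of this lineage.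
PROOF TYPED HERE.  `d = P − q_n` has degree `< n` (two monics), so the cross term `Σ ν q_n d` vanishes; for the converse, `ε ↦ Σ ν (P + ε G)²` is a quadratic `≥ Σ ν P²` for all `ε`,
whence its linear coefficient `2 Σ ν P G` vanishes.
DEDUP DISCLOSURE (`rg -n 'extremal|minimis|minimiz' Summits/Ventures/HSemireg/WedgeHankelRecurrence*`, 2026-09-02): N264 ∕ N272 use «extreme» for node positions only; nothing on the
`L²`-extremal property; the first-variation lemma exists elsewhere under the short name `eq_zero_of_forall_quadratic_nonneg` (QuantumLattice ∕ QuantumManyBody ∕ BEC, other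
namespaces, not imported) and is restated here in two lines as `eq_zero_of_forall_two_mul_add_sq_mul_nonneg`.  The 5 names below: 0 hits tree-wide.

WHAT IS IN THE TREE.  N273 `natDegree_sub_lt_of_monic_of_natDegree_eq`, `eq_zero_of_sum_mul_eval_sq_eq_zero`; Mathlib `Polynomial.eq_one_of_monic_natDegree_zero`.
THIS FILE (namespace `Summit.Ventures.HSemireg.Wedge.HankelOuter` continued; CHAINED on N274 (import) and N273; 0 definitions):
* §1040 `sum_sq_eq_sum_sq_add_sum_sq_sub` (PYTHAGORAS), **`sum_sq_orthogonal_le_sum_sq_monic`** (Szegő Thm 3.1.2: the minimum), **`eq_orthogonal_of_sum_sq_eq`** (uniqueness of the minimiser),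
  `eq_zero_of_forall_two_mul_add_sq_mul_nonneg` (first-variation lemma: `∀ ε, 0 ≤ 2εA + ε²B`, `B ≥ 0` ⇒ `A = 0`), **`orthogonal_of_isMin_monic`** (a monic minimiser is orthogonal to lower degrees).
CAVEATS.  Nothing Ext-side.  New names only.
-/

open Module Polynomial
open scoped Matrix Polynomial

namespace Summit.Ventures.HSemireg.Wedge.HankelOuter

/-! ## §1040. The extremal property -/

/-- **Pythagoras**: if `q` is monic of degree `n`, `(ν, w)`-orthogonal to all `G` with `deg G < n`, and `P` is monic of degree `n`, then `Σ ν P(w)² = Σ ν q(w)² + Σ ν (P − q)(w)²`.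
[Szegő Thm 3.1.2, proof; this file, §1040] -/
theorem sum_sq_eq_sum_sq_add_sum_sq_sub {N n : ℕ} {ν w : Fin N → ℝ} {q P : ℝ[X]} (hqm : q.Monic) (hqd : q.natDegree = n)
    (hqo : ∀ G : ℝ[X], G.natDegree < n → ∑ l, ν l * (q * G).eval (w l) = 0) (hPm : P.Monic) (hPd : P.natDegree = n) :
    ∑ l, ν l * (P.eval (w l)) ^ 2 = ∑ l, ν l * (q.eval (w l)) ^ 2 + ∑ l, ν l * ((P - q).eval (w l)) ^ 2 := by
  -- the cross term vanishes
  have hcross : ∑ l, ν l * (q.eval (w l) * (P - q).eval (w l)) = 0 := by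
    rcases Nat.eq_zero_or_pos n with hn | hn
    · subst hn
      have hP1 : P = 1 := eq_one_of_monic_natDegree_zero hPm hPd
      have hq1 : q = 1 := eq_one_of_monic_natDegree_zero hqm hqd
      simp [hP1, hq1]
    · have h := hqo (P - q) (natDegree_sub_lt_of_monic_of_natDegree_eq hn hPm hPd hqm hqd)
      simpa only [eval_mul] using h
  have hexp : ∀ l, ν l * (P.eval (w l)) ^ 2 = ν l * (q.eval (w l)) ^ 2 + ν l * ((P - q).eval (w l)) ^ 2 + 2 * (ν l * (q.eval (w l) * (P - q).eval (w l))) := fun l => by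
    rw [eval_sub]; ring
  rw [Finset.sum_congr rfl fun l _ => hexp l, Finset.sum_add_distrib, Finset.sum_add_distrib, ← Finset.mul_sum, hcross, mul_zero, add_zero]

/-- **THE EXTREMAL PROPERTY (Szegő Thm 3.1.2)**: with `ν ≥ 0`, the monic orthogonal polynomial of degree `n` minimises `Σ_l ν_l P(w_l)²` over all monic `P` of degree `n`.
[Szegő Thm 3.1.2; Chihara I §3; this file, §1040] -/
theorem sum_sq_orthogonal_le_sum_sq_monic {N n : ℕ} {ν w : Fin N → ℝ} (hν : ∀ l, 0 ≤ ν l) {q P : ℝ[X]} (hqm : q.Monic) (hqd : q.natDegree = n)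
    (hqo : ∀ G : ℝ[X], G.natDegree < n → ∑ l, ν l * (q * G).eval (w l) = 0) (hPm : P.Monic) (hPd : P.natDegree = n) :
    ∑ l, ν l * (q.eval (w l)) ^ 2 ≤ ∑ l, ν l * (P.eval (w l)) ^ 2 := by
  rw [sum_sq_eq_sum_sq_add_sum_sq_sub hqm hqd hqo hPm hPd]
  exact le_add_of_nonneg_right (Finset.sum_nonneg fun l _ => mul_nonneg (hν l) (sq_nonneg _))

/-- **Uniqueness of the minimiser**: with `ν > 0`, `w` injective and `n < N`, a monic `P` of degree `n` with `Σ ν P(w)² = Σ ν q(w)²` equals `q`. [Szegő Thm 3.1.2; this file, §1040] -/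
theorem eq_orthogonal_of_sum_sq_eq {N n : ℕ} {ν w : Fin N → ℝ} (hν : ∀ l, 0 < ν l) (hw : Function.Injective w) (hnN : n < N) {q P : ℝ[X]} (hqm : q.Monic) (hqd : q.natDegree = n)
    (hqo : ∀ G : ℝ[X], G.natDegree < n → ∑ l, ν l * (q * G).eval (w l) = 0) (hPm : P.Monic) (hPd : P.natDegree = n)
    (heq : ∑ l, ν l * (P.eval (w l)) ^ 2 = ∑ l, ν l * (q.eval (w l)) ^ 2) : P = q := by
  have h := sum_sq_eq_sum_sq_add_sum_sq_sub hqm hqd hqo hPm hPd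
  rw [heq] at h
  have h0 : ∑ l, ν l * ((P - q).eval (w l)) ^ 2 = 0 := by linarith
  have hdeg : (P - q).natDegree < N := lt_of_le_of_lt ((natDegree_sub_le P q).trans (by rw [hPd, hqd, max_self])) hnN
  exact sub_eq_zero.1 (eq_zero_of_sum_mul_eval_sq_eq_zero hν hw hdeg h0)

/-- **First-variation lemma**: if `0 ≤ 2εA + ε²B` for every real `ε`, with `B ≥ 0`, then `A = 0`. [calculus; this file, §1040] -/
theorem eq_zero_of_forall_two_mul_add_sq_mul_nonneg {A B : ℝ} (hB : 0 ≤ B) (h : ∀ ε : ℝ, 0 ≤ 2 * ε * A + ε ^ 2 * B) : A = 0 := by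
  by_contra hA
  have hB1 : 0 < B + 1 := by linarith
  have hε := h (-A / (B + 1))
  have hA2 : 0 < A ^ 2 := by positivity
  -- `2εA + ε²B = −A²(B + 2)/(B + 1)² < 0`
  have hcalc : 2 * (-A / (B + 1)) * A + (-A / (B + 1)) ^ 2 * B = -(A ^ 2 * (B + 2)) / (B + 1) ^ 2 := by
    field_simp
    ring
  rw [hcalc] at hε
  have : 0 < A ^ 2 * (B + 2) / (B + 1) ^ 2 := by positivity
  rw [neg_div] at hε
  linarith

/-- **CONVERSE — a monic minimiser is orthogonal to lower degrees**: if `P` is monic of degree `n` and `Σ ν P(w)² ≤ Σ ν Q(w)²` for every monic `Q` of degree `n` (`ν ≥ 0`), then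
`Σ ν P(w) G(w) = 0` for every `G` with `deg G < n`. [Szegő Thm 3.1.2; this file, §1040] -/
theorem orthogonal_of_isMin_monic {N n : ℕ} {ν w : Fin N → ℝ} (hν : ∀ l, 0 ≤ ν l) {P : ℝ[X]} (hPm : P.Monic) (hPd : P.natDegree = n)
    (hmin : ∀ Q : ℝ[X], Q.Monic → Q.natDegree = n → ∑ l, ν l * (P.eval (w l)) ^ 2 ≤ ∑ l, ν l * (Q.eval (w l)) ^ 2) {G : ℝ[X]} (hG : G.natDegree < n) :
    ∑ l, ν l * (P * G).eval (w l) = 0 := by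
  -- `P + ε G` is monic of degree `n` for every `ε`
  have hQ : ∀ ε : ℝ, (P + C ε * G).Monic ∧ (P + C ε * G).natDegree = n := fun ε => by
    have hdeg : (C ε * G).degree < P.degree := by
      rw [degree_eq_natDegree hPm.ne_zero, hPd]
      refine lt_of_le_of_lt (degree_mul_le _ _) ?_
      refine lt_of_le_of_lt (add_le_add degree_C_le degree_le_natDegree) ?_
      rw [zero_add]; exact_mod_cast hG
    exact ⟨hPm.add_of_left hdeg, by rw [natDegree_add_eq_left_of_degree_lt hdeg, hPd]⟩
  set A := ∑ l, ν l * (P * G).eval (w l) with hA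
  set B := ∑ l, ν l * (G.eval (w l)) ^ 2 with hB
  have hB0 : 0 ≤ B := Finset.sum_nonneg fun l _ => mul_nonneg (hν l) (sq_nonneg _)
  refine eq_zero_of_forall_two_mul_add_sq_mul_nonneg hB0 fun ε => ?_
  have h := hmin _ (hQ ε).1 (hQ ε).2
  have hexp : ∑ l, ν l * ((P + C ε * G).eval (w l)) ^ 2 = ∑ l, ν l * (P.eval (w l)) ^ 2 + (2 * ε * A + ε ^ 2 * B) := by
    rw [hA, hB, Finset.mul_sum, Finset.mul_sum, ← Finset.sum_add_distrib, ← Finset.sum_add_distrib]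
    refine Finset.sum_congr rfl fun l _ => ?_
    simp only [eval_add, eval_mul, eval_C]
    ring
  rw [hexp] at h
  linarith

end Summit.Ventures.HSemireg.Wedge.HankelOuter
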